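import Mathlib.RingTheory.MvPolynomial.EulerIdentity
import Literature.RingTheory.MvPolynomial.LinearFormsCoeff
import Summits.ValiantsHypothesis.ValiantsHypothesis.Theorems.LiftNullstellensatzLiftWidthPerFourCaseAZero
import Summits.ValiantsHypothesis.ValiantsHypothesis.Theorems.LiftNullstellensatzLiftWidthPerFourCaseAOfVPlus

/-!
# Route LiftNullstellensatz — `LiftWidthPerFour` (stmt-ValiantsHypothesis-5922), CASE A rung 1.5:
the extra linear forms `ℓ, ℓ'` supported on the two rows

Second rung of `stub_caseA` (line `outer_layers`; `--supports stmt-ValiantsHypothesis-5922`, prover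
val-width-5922-p2 g0); rung 1 (`caseA_zero`, `…CaseAZero.lean`) is `ℓ = ℓ' = 0`.  Here
`ℓ = Σ α_j x_{i₀j} + Σ u_k x_{i₁k}`, `ℓ' = Σ u'_j x_{i₀j} + Σ β_k x_{i₁k}` are ARBITRARY linear forms
supported on the rows `i₀ ≠ i₁` — the whole branch `λ = λ' = 0` (all `u, u'`) of the reduction
`ℓ = λ(y,z) + u·ξ`, `ℓ' = λ'(y,z) + u'·x` of `CASEA-RUNG1-p2.md` §4, previously open for `u, u' ≠ 0`.
Proof (`caseA_twoRow`): with `κ₀` killing both rows, `Ã_{js} = κ₀(∂_{i₀j} v_s)`,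
`C̃_{sk} = κ₀(∂_{i₁k} v'_s)`, `b̂_s, d̂_s` the `κ₀`-parts of the `ℓ`-, `ℓ'`-coefficients of `v_s, v'_s`,
the operators `κ₀∂_{i₁k}∂_{i₀j}`, `κ₀∂_{i₀j'}∂_{i₀j}`, `κ₀∂_{i₁k'}∂_{i₁k}` applied to `per_4 = Σ v_s v'_s`
(bidegrees `(1,1)`, `(2,0)`, `(0,2)` in the two rows) give `∂²per = ÃC̃ + φ·u'uᵀ`,
`u' ≠ 0 ⇒ Ãd̂ = 0`, `u ≠ 0 ⇒ b̂ᵀC̃ = 0` (`char K ≠ 2`); so the REGROUPED `P = Ã + u'b̂ᵀ`,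
`P' = C̃ + d̂uᵀ` (switched off when `u = 0` / `u' = 0`) satisfy `PP' = ∂²per`, and by the double row
expansion `per_4 = Σ_{j,k} x_{i₀j} x_{i₁k} ∂²per` (Euler's identity for row weights) the quadrics
`V_s = Σ_j x_{i₀j} P_{js}`, `V'_s = Σ_k x_{i₁k} P'_{sk}` are an EXACT format-`(4,5,4)` program for
`per_4` — impossible by `caseA_zero`.  `caseA_of_coeff_eq_zero`: the binder shape of the stub.
Remaining for `stub_caseA`: a non-zero component `λ` or `λ'` off the two rows (the `(V⁺)` programme,
`STAGED-CERT-p1g2.md`).  No new definitions.  VP ≠ VNP is not moved by this item.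
-/

noncomputable section

open MvPolynomial Matrix Finset

namespace Summit.ValiantsHypothesis.LiftNullstellensatz

open Literature.Computability.AlgebraicComplexity
open Literature.Computability.AlgebraicComplexity.VonZurGathen

variable {K : Type*} [Field K]

/-! ### Row expansions of the generic permanent (Euler's identity for row weights) -/

section Expansion

variable {ι : Type*} [Fintype ι] [DecidableEq ι]

/-- The generic permanent has weight `1` for the indicator weight of a row `r`: every monomial
contains exactly one variable of row `r`. [folklore] -/
theorem perPoly_isWeightedHomogeneous_row (r : ι) :
    (perPoly ι K).IsWeightedHomogeneous (fun v : ι × ι => if v.1 = r then 1 else 0) 1 := by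
  unfold perPoly Matrix.permanent
  refine IsWeightedHomogeneous.sum _ _ _ fun π _ => ?_
  have h := IsWeightedHomogeneous.prod (w := fun v : ι × ι => if v.1 = r then 1 else 0) univ
    (fun i : ι => Matrix.mvPolynomialX ι ι K (π i) i) (fun i => if π i = r then 1 else 0)
    fun i _ => by
      simpa [Matrix.mvPolynomialX] using
        isWeightedHomogeneous_X K (fun v : ι × ι => if v.1 = r then 1 else 0) (π i, i)
  have hsum : ∑ i ∈ univ, (if π i = r then 1 else 0 : ℕ) = 1 := by
    rw [Equiv.sum_comp π (fun j => if j = r then (1 : ℕ) else 0)]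
    simp
  rw [hsum] at h
  exact h

/-- **Row expansion** `per = Σ_c x_{rc} · ∂per/∂x_{rc}` (Euler's identity for the row weight).
[folklore] -/
theorem perPoly_eq_sum_X_mul_pderiv_row (r : ι) :
    perPoly ι K = ∑ c, X (r, c) * pderiv (r, c) (perPoly ι K) := by
  have h := (perPoly_isWeightedHomogeneous_row (K := K) r).sum_weight_X_mul_pderiv
  rw [one_smul, Fintype.sum_prod_type, ← Finset.sum_erase_add _ _ (Finset.mem_univ r),
    Finset.sum_eq_zero fun r' hr' => ?_, zero_add] at h
  · conv_lhs => rw [← h]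
    simp
  · rw [Finset.mem_erase] at hr'
    simp [hr'.1]

/-- **Double row expansion** `per = Σ_{j,k} x_{r j} x_{r' k} · ∂²per/∂x_{r' k}∂x_{r j}` for two
different rows `r ≠ r'`. [folklore] -/
theorem perPoly_eq_sum_X_mul_X_mul_pderiv_pderiv {r r' : ι} (hrr' : r ≠ r') :
    perPoly ι K = ∑ j, ∑ k, X (r, j) * X (r', k) *
      pderiv (r', k) (pderiv (r, j) (perPoly ι K)) := by
  conv_lhs => rw [perPoly_eq_sum_X_mul_pderiv_row (K := K) r]
  refine Finset.sum_congr rfl fun j _ => ?_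
  have hw : (pderiv (r, j) (perPoly ι K)).IsWeightedHomogeneous
      (fun v : ι × ι => if v.1 = r' then 1 else 0) 1 :=
    (perPoly_isWeightedHomogeneous_row (K := K) r').pderiv (by simp [hrr'])
  have h := hw.sum_weight_X_mul_pderiv
  rw [one_smul, Fintype.sum_prod_type, ← Finset.sum_erase_add _ _ (Finset.mem_univ r'),
    Finset.sum_eq_zero fun r'' hr'' => ?_, zero_add] at h
  · conv_lhs => rw [← h]
    rw [Finset.mul_sum]
    refine Finset.sum_congr rfl fun k _ => ?_
    simp only [if_true, one_smul]
    ring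
  · rw [Finset.mem_erase] at hr''
    simp [hr''.1]

/-- `∂²per/∂x_{r c}∂x_{r c'} = 0`: the permanent is linear in each row. [folklore] -/
theorem pderiv_pderiv_perPoly_same_row (r c c' : ι) :
    pderiv (r, c') (pderiv (r, c) (perPoly ι K)) = 0 := by
  rw [pderiv_perPoly, pderiv_subperm_X_eq_zero _ _ (by simp)]

/-- The substitution killing two rows `r, r'` fixes `∂²per/∂x_{r' k}∂x_{r j}` (a subpermanent of the
other rows). [folklore] -/
theorem aeval_killRows_pderiv_pderiv_perPoly {r r' : ι} (hrr' : r ≠ r') (j k : ι) :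
    aeval (fun w : ι × ι => if w.1 = r ∨ w.1 = r' then (0 : MvPolynomial (ι × ι) K) else X w)
      (pderiv (r', k) (pderiv (r, j) (perPoly ι K))) =
      pderiv (r', k) (pderiv (r, j) (perPoly ι K)) := by
  rw [pderiv_perPoly]
  have hcongr : (mvPolynomialX ι ι K).subperm (· ≠ j) (· ≠ r) =
      (mvPolynomialX ι ι K).subperm (· ∈ Finset.univ.erase j) (· ∈ Finset.univ.erase r) :=
    (mvPolynomialX ι ι K).subperm_congr (fun i => by simp) (fun i => by simp)
  rw [hcongr]
  by_cases hjk : k = j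
  · subst hjk
    rw [pderiv_subperm_X_col _ _ (by simp), map_zero]
  rw [pderiv_subperm_X_mem _ _ (by simp [hrr'.symm]) (by simp [hjk]), aeval_subperm_X]
  unfold Matrix.subperm
  refine Finset.sum_congr rfl fun f _ => Finset.prod_congr rfl fun i _ => ?_
  have hfi := (f i).2
  simp only [Finset.mem_erase, Finset.mem_univ, and_true] at hfi
  simp [Matrix.of_apply, Matrix.mvPolynomialX_apply, hfi.1, hfi.2]

end Expansion

/-! ### Rung 1.5: the extra forms `ℓ, ℓ'` are supported on the two rows -/

/-- **CASE A when `ℓ, ℓ'` are supported on the rows `i₀ ≠ i₁`** (`ℓ = Σ α_j x_{i₀j} + Σ u_k x_{i₁k}`,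
`ℓ' = Σ u'_j x_{i₀j} + Σ β_k x_{i₁k}`, any `α, u, u', β`; `char K ≠ 2`): `per_4` is not a sum of `b ≤ 5`
products of quadrics `v_s ∈ (x_{i₀·}, ℓ)`, `v'_s ∈ (x_{i₁·}, ℓ')`.  Regrouping `(Ã + u'b̂ᵀ)(C̃ + d̂uᵀ) = ∂²per`
of the bidegree pieces gives an exact `(4,5,4)` program, impossible by `caseA_zero` (module
docstring). [cite: BlaserIkenmeyerMahajanPandeySaurabh2020, §2 (problem)] -/
theorem caseA_twoRow (h2 : (2 : K) ≠ 0) (b : ℕ) (hb : b ≤ 5) (i₀ i₁ : Fin 4) (hi : i₀ ≠ i₁)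
    (α u u' β : Fin 4 → K) (v v' : Fin b → MvPolynomial (Fin 4 × Fin 4) K)
    (hv : ∀ s, v s ∈ Ideal.span (insert
      (∑ j, C (α j) * X (i₀, j) + ∑ k, C (u k) * X (i₁, k) : MvPolynomial (Fin 4 × Fin 4) K)
      (Set.range fun j : Fin 4 => (X (i₀, j) : MvPolynomial (Fin 4 × Fin 4) K))))
    (hv2 : ∀ s, (v s).IsHomogeneous 2)
    (hv' : ∀ s, v' s ∈ Ideal.span (insert
      (∑ j, C (u' j) * X (i₀, j) + ∑ k, C (β k) * X (i₁, k) : MvPolynomial (Fin 4 × Fin 4) K)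
      (Set.range fun k : Fin 4 => (X (i₁, k) : MvPolynomial (Fin 4 × Fin 4) K))))
    (hv'2 : ∀ s, (v' s).IsHomogeneous 2) :
    perPoly (Fin 4) K ≠ ∑ s, v s * v' s := by
  classical
  intro hper
  set ℓ : MvPolynomial (Fin 4 × Fin 4) K := ∑ j, C (α j) * X (i₀, j) + ∑ k, C (u k) * X (i₁, k)
  set ℓ' : MvPolynomial (Fin 4 × Fin 4) K := ∑ j, C (u' j) * X (i₀, j) + ∑ k, C (β k) * X (i₁, k)
  have hlin : ∀ a c : Fin 4 → K, ∀ r r' : Fin 4,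
      (∑ j, C (a j) * X (r, j) + ∑ k, C (c k) * X (r', k) :
        MvPolynomial (Fin 4 × Fin 4) K).IsHomogeneous 1 := fun a c r r' =>
    (IsHomogeneous.sum _ _ _ fun j _ => (isHomogeneous_X K (r, j)).C_mul (a j)).add
      (IsHomogeneous.sum _ _ _ fun k _ => (isHomogeneous_X K (r', k)).C_mul (c k))
  have hℓ1 : ℓ.IsHomogeneous 1 := hlin α u i₀ i₁
  have hℓ'1 : ℓ'.IsHomogeneous 1 := hlin u' β i₀ i₁
  -- Step A: linear coefficient vectors of the quadrics
  set Xh : Fin 5 → MvPolynomial (Fin 4 × Fin 4) K :=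
    Fin.cons ℓ (fun j : Fin 4 => (X (i₀, j) : MvPolynomial (Fin 4 × Fin 4) K)) with hXh
  set Ξh : Fin 5 → MvPolynomial (Fin 4 × Fin 4) K :=
    Fin.cons ℓ' (fun k : Fin 4 => (X (i₁, k) : MvPolynomial (Fin 4 × Fin 4) K)) with hΞh
  have hXh1 : ∀ i, (Xh i).IsHomogeneous 1 := fun i => by
    refine Fin.cases ?_ (fun j => ?_) i
    · simpa [hXh] using hℓ1
    · simpa [hXh] using isHomogeneous_X K (i₀, j)
  have hΞh1 : ∀ i, (Ξh i).IsHomogeneous 1 := fun i => by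
    refine Fin.cases ?_ (fun k => ?_) i
    · simpa [hΞh] using hℓ'1
    · simpa [hΞh] using isHomogeneous_X K (i₁, k)
  have hrange : Set.range Xh = insert ℓ (Set.range fun j : Fin 4 =>
      (X (i₀, j) : MvPolynomial (Fin 4 × Fin 4) K)) := by rw [hXh, Fin.range_cons]
  have hrange' : Set.range Ξh = insert ℓ' (Set.range fun k : Fin 4 =>
      (X (i₁, k) : MvPolynomial (Fin 4 × Fin 4) K)) := by rw [hΞh, Fin.range_cons]
  have hc : ∀ s, ∃ c : Fin 5 → MvPolynomial (Fin 4 × Fin 4) K,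
      (∀ i, (c i).IsHomogeneous 1) ∧ v s = ∑ i, Xh i * c i := fun s =>
    exists_linear_coeffs_of_mem_span Xh hXh1 (hv2 s) (by rw [hrange]; exact hv s)
  have hc' : ∀ s, ∃ c : Fin 5 → MvPolynomial (Fin 4 × Fin 4) K,
      (∀ i, (c i).IsHomogeneous 1) ∧ v' s = ∑ i, Ξh i * c i := fun s =>
    exists_linear_coeffs_of_mem_span Ξh hΞh1 (hv'2 s) (by rw [hrange']; exact hv' s)
  choose c hc1 hcv using hc
  choose c' hc'1 hc'v using hc'
  -- Step B: the substitution κ₀ killing both rows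
  set g : Fin 4 × Fin 4 → MvPolynomial (Fin 4 × Fin 4) K :=
    fun w => if w.1 = i₀ ∨ w.1 = i₁ then 0 else X w with hg
  set κ : MvPolynomial (Fin 4 × Fin 4) K →ₐ[K] MvPolynomial (Fin 4 × Fin 4) K := aeval g with hκ
  have hg1 : ∀ w, (g w).IsHomogeneous 1 := fun w => by
    simp only [hg]; split_ifs
    · exact isHomogeneous_zero _ _ _
    · exact isHomogeneous_X K w
  have hκX0 : ∀ j, κ (X (i₀, j)) = 0 := fun j => by rw [hκ, aeval_X, hg]; simp
  have hκX1 : ∀ k, κ (X (i₁, k)) = 0 := fun k => by rw [hκ, aeval_X, hg]; simp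
  have hκℓ : κ ℓ = 0 := by simp [ℓ, map_add, map_sum, map_mul, hκX0, hκX1]
  have hκℓ' : κ ℓ' = 0 := by simp [ℓ', map_add, map_sum, map_mul, hκX0, hκX1]
  have hκXh : ∀ i, κ (Xh i) = 0 := fun i => by
    refine Fin.cases ?_ (fun j => ?_) i
    · simpa [hXh] using hκℓ
    · simpa [hXh] using hκX0 j
  have hκΞh : ∀ i, κ (Ξh i) = 0 := fun i => by
    refine Fin.cases ?_ (fun k => ?_) i
    · simpa [hΞh] using hκℓ'
    · simpa [hΞh] using hκX1 k
  have hκv : ∀ s, κ (v s) = 0 := fun s => by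
    rw [hcv s, map_sum]
    exact Finset.sum_eq_zero fun i _ => by rw [map_mul, hκXh, zero_mul]
  have hκv' : ∀ s, κ (v' s) = 0 := fun s => by
    rw [hc'v s, map_sum]
    exact Finset.sum_eq_zero fun i _ => by rw [map_mul, hκΞh, zero_mul]
  -- derivatives of the generators across the rows
  have hdℓ : ∀ k, pderiv (i₁, k) ℓ = C (u k) := fun k => by
    simp [ℓ, map_add, map_sum, Derivation.leibniz, pderiv_X, Pi.single_apply, hi]
  have hdℓ' : ∀ j, pderiv (i₀, j) ℓ' = C (u' j) := fun j => by
    simp [ℓ', map_add, map_sum, Derivation.leibniz, pderiv_X, Pi.single_apply, hi.symm]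
  have hdXh : ∀ k i, κ (pderiv (i₁, k) (Xh i)) = if i = 0 then C (u k) else 0 := fun k i => by
    refine Fin.cases ?_ (fun j => ?_) i
    · simp [hXh, hdℓ, hκ]
    · have hne : ((i₀, j) : Fin 4 × Fin 4) ≠ (i₁, k) := fun h => hi (Prod.mk.inj h).1
      simp [hXh, pderiv_X, hne, Fin.succ_ne_zero]
  have hdΞh : ∀ j i, κ (pderiv (i₀, j) (Ξh i)) = if i = 0 then C (u' j) else 0 := fun j i => by
    refine Fin.cases ?_ (fun k => ?_) i
    · simp [hΞh, hdℓ', hκ]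
    · have hne : ((i₁, k) : Fin 4 × Fin 4) ≠ (i₀, j) := fun h => hi (Prod.mk.inj h).1.symm
      simp [hΞh, pderiv_X, hne, Fin.succ_ne_zero]
  -- the κ₀-parts of the ℓ-, ℓ'-coefficients
  set bh : Fin b → MvPolynomial (Fin 4 × Fin 4) K := fun s => κ (c s 0) with hbh
  set dh : Fin b → MvPolynomial (Fin 4 × Fin 4) K := fun s => κ (c' s 0) with hdh
  have F3 : ∀ s k, κ (pderiv (i₁, k) (v s)) = C (u k) * bh s := fun s k => by
    rw [hcv s, map_sum, map_sum]
    simp only [Derivation.leibniz, smul_eq_mul, map_add, map_mul, hκXh, zero_mul, zero_add, hdXh]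
    rw [Fin.sum_univ_succ]
    simp [hbh, mul_comm]
  have F4 : ∀ s j, κ (pderiv (i₀, j) (v' s)) = C (u' j) * dh s := fun s j => by
    rw [hc'v s, map_sum, map_sum]
    simp only [Derivation.leibniz, smul_eq_mul, map_add, map_mul, hκΞh, zero_mul, zero_add, hdΞh]
    rw [Fin.sum_univ_succ]
    simp [hdh, mul_comm]
  -- Step C: the three bidegree identities
  have e11 : ∀ j k, κ (pderiv (i₁, k) (pderiv (i₀, j) (perPoly (Fin 4) K))) =
      ∑ s, (κ (pderiv (i₀, j) (v s)) * κ (pderiv (i₁, k) (v' s)) +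
        C (u k) * bh s * (C (u' j) * dh s)) := fun j k => by
    rw [hper, map_sum, map_sum, map_sum]
    refine Finset.sum_congr rfl fun s _ => ?_
    simp only [Derivation.leibniz, smul_eq_mul, map_add, map_mul, hκv, hκv', F3, F4, zero_mul,
      zero_add]
    ring
  have e20 : ∀ j j', ∑ s, (C (u' j) * dh s * κ (pderiv (i₀, j') (v s)) +
      κ (pderiv (i₀, j) (v s)) * (C (u' j') * dh s)) = 0 := fun j j' => by
    have h0 := congrArg κ (pderiv_pderiv_perPoly_same_row (K := K) i₀ j j')
    rw [map_zero, hper, map_sum, map_sum, map_sum] at h0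
    rw [← h0]
    refine Finset.sum_congr rfl fun s _ => ?_
    simp only [Derivation.leibniz, smul_eq_mul, map_add, map_mul, hκv, hκv', F4, zero_mul,
      zero_add]
  have e02 : ∀ k k', ∑ s, (κ (pderiv (i₁, k) (v' s)) * (C (u k') * bh s) +
      C (u k) * bh s * κ (pderiv (i₁, k') (v' s))) = 0 := fun k k' => by
    have h0 := congrArg κ (pderiv_pderiv_perPoly_same_row (K := K) i₁ k k')
    rw [map_zero, hper, map_sum, map_sum, map_sum] at h0
    rw [← h0]
    refine Finset.sum_congr rfl fun s _ => ?_
    simp only [Derivation.leibniz, smul_eq_mul, map_add, map_mul, hκv, hκv', F3, zero_mul,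
      zero_add]
  -- Step D: `Ãd̂ = 0` if `u' ≠ 0`, `b̂ᵀC̃ = 0` if `u ≠ 0`
  set w : Fin 4 → MvPolynomial (Fin 4 × Fin 4) K :=
    fun j => ∑ s, κ (pderiv (i₀, j) (v s)) * dh s with hw
  set w' : Fin 4 → MvPolynomial (Fin 4 × Fin 4) K :=
    fun k => ∑ s, bh s * κ (pderiv (i₁, k) (v' s)) with hw'
  have e20' : ∀ j j', C (u' j') * w j + C (u' j) * w j' = 0 := fun j j' => by
    rw [← e20 j j', hw]
    simp only
    rw [Finset.mul_sum, Finset.mul_sum, ← Finset.sum_add_distrib]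
    exact Finset.sum_congr rfl fun s _ => by ring
  have e02' : ∀ k k', C (u k') * w' k + C (u k) * w' k' = 0 := fun k k' => by
    rw [← e02 k k', hw']
    simp only
    rw [Finset.mul_sum, Finset.mul_sum, ← Finset.sum_add_distrib]
    exact Finset.sum_congr rfl fun s _ => by ring
  have hC2 : ∀ a : K, a ≠ 0 → (C a + C a : MvPolynomial (Fin 4 × Fin 4) K) ≠ 0 := fun a ha => by
    rw [← map_add, Ne, C_eq_zero, ← two_mul, mul_eq_zero, not_or]
    exact ⟨h2, ha⟩
  have hw0 : u' ≠ 0 → ∀ j, w j = 0 := fun hu' j => by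
    obtain ⟨j₀, hj₀⟩ : ∃ j₀, u' j₀ ≠ 0 := by by_contra h; push Not at h; exact hu' (funext h)
    have h00 : w j₀ = 0 := by
      have := e20' j₀ j₀
      rw [← add_mul] at this
      exact (mul_eq_zero.1 this).resolve_left (hC2 _ hj₀)
    have := e20' j j₀
    rw [h00, mul_zero, add_zero] at this
    exact (mul_eq_zero.1 this).resolve_left ((C_eq_zero.not).2 hj₀)
  have hw'0 : u ≠ 0 → ∀ k, w' k = 0 := fun hu k => by
    obtain ⟨k₀, hk₀⟩ : ∃ k₀, u k₀ ≠ 0 := by by_contra h; push Not at h; exact hu (funext h)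
    have h00 : w' k₀ = 0 := by
      have := e02' k₀ k₀
      rw [← add_mul] at this
      exact (mul_eq_zero.1 this).resolve_left (hC2 _ hk₀)
    have := e02' k k₀
    rw [h00, mul_zero, add_zero] at this
    exact (mul_eq_zero.1 this).resolve_left ((C_eq_zero.not).2 hk₀)
  -- Step E: the regrouped program (ε-switches cover `u = 0` / `u' = 0`)
  let ε : K := if u' = 0 then 0 else 1
  let ε' : K := if u = 0 then 0 else 1
  have hεw : ∀ j, C ε * w j = 0 := fun j => by
    by_cases hu' : u' = 0
    · simp [ε, hu']
    · rw [hw0 hu' j, mul_zero]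
  have hε'w' : ∀ k, C ε' * w' k = 0 := fun k => by
    by_cases hu : u = 0
    · simp [ε', hu]
    · rw [hw'0 hu k, mul_zero]
  have hεε' : ∀ j k, (C (u' j) * C (u k) * (C ε' * C ε) : MvPolynomial (Fin 4 × Fin 4) K) =
      C (u' j) * C (u k) := fun j k => by
    by_cases hu : u = 0
    · simp [hu]
    by_cases hu' : u' = 0
    · simp [hu']
    simp [ε, ε', hu, hu']
  let P : Fin 4 → Fin b → MvPolynomial (Fin 4 × Fin 4) K :=
    fun j s => κ (pderiv (i₀, j) (v s)) + C (u' j) * (C ε' * bh s)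
  let P' : Fin b → Fin 4 → MvPolynomial (Fin 4 × Fin 4) K :=
    fun s k => κ (pderiv (i₁, k) (v' s)) + C (u k) * (C ε * dh s)
  have hbh1 : ∀ s, (bh s).IsHomogeneous 1 := fun s =>
    isHomogeneous_aeval_of_forall g hg1 (hc1 s 0)
  have hdh1 : ∀ s, (dh s).IsHomogeneous 1 := fun s =>
    isHomogeneous_aeval_of_forall g hg1 (hc'1 s 0)
  have hP1 : ∀ j s, (P j s).IsHomogeneous 1 := fun j s =>
    (isHomogeneous_aeval_of_forall g hg1 (by simpa using (hv2 s).pderiv (i := (i₀, j)))).add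
      (((hbh1 s).C_mul _).C_mul _)
  have hP'1 : ∀ s k, (P' s k).IsHomogeneous 1 := fun s k =>
    (isHomogeneous_aeval_of_forall g hg1 (by simpa using (hv'2 s).pderiv (i := (i₁, k)))).add
      (((hdh1 s).C_mul _).C_mul _)
  have hPP : ∀ j k, ∑ s, P j s * P' s k =
      pderiv (i₁, k) (pderiv (i₀, j) (perPoly (Fin 4) K)) := fun j k => by
    have step : ∑ s, P j s * P' s k =
        ∑ s, (κ (pderiv (i₀, j) (v s)) * κ (pderiv (i₁, k) (v' s)) +
          C (u k) * bh s * (C (u' j) * dh s)) + C (u k) * (C ε * w j) + C (u' j) * (C ε' * w' k) := by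
      simp only [P, P', hw, hw', Finset.mul_sum, ← Finset.sum_add_distrib]
      refine Finset.sum_congr rfl fun s _ => ?_
      linear_combination (bh s * dh s) * hεε' j k
    rw [step, hεw, hε'w', mul_zero, mul_zero, add_zero, add_zero, ← e11 j k, hκ, hg]
    exact aeval_killRows_pderiv_pderiv_perPoly hi j k
  -- the exact `(4,5,4)` program contradicts rung 1
  let V : Fin b → MvPolynomial (Fin 4 × Fin 4) K := fun s => ∑ j, X (i₀, j) * P j s
  let V' : Fin b → MvPolynomial (Fin 4 × Fin 4) K := fun s => ∑ k, X (i₁, k) * P' s k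
  refine caseA_zero h2 b hb i₀ i₁ hi V V' (fun s => ?_) (fun s => ?_) (fun s => ?_) (fun s => ?_) ?_
  · exact Ideal.sum_mem _ fun j _ => Ideal.mul_mem_right _ _ (Ideal.subset_span ⟨j, rfl⟩)
  · exact IsHomogeneous.sum _ _ _ fun j _ => (isHomogeneous_X K (i₀, j)).mul (hP1 j s)
  · exact Ideal.sum_mem _ fun k _ => Ideal.mul_mem_right _ _ (Ideal.subset_span ⟨k, rfl⟩)
  · exact IsHomogeneous.sum _ _ _ fun k _ => (isHomogeneous_X K (i₁, k)).mul (hP'1 s k)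
  · calc perPoly (Fin 4) K
        = ∑ j, ∑ k, X (i₀, j) * X (i₁, k) * pderiv (i₁, k) (pderiv (i₀, j) (perPoly (Fin 4) K)) :=
          perPoly_eq_sum_X_mul_X_mul_pderiv_pderiv hi
      _ = ∑ j, ∑ k, X (i₀, j) * X (i₁, k) * ∑ s, P j s * P' s k := by
          simp_rw [hPP]
      _ = ∑ j, ∑ k, ∑ s, (X (i₀, j) * P j s) * (X (i₁, k) * P' s k) := by
          refine Finset.sum_congr rfl fun j _ => Finset.sum_congr rfl fun k _ => ?_
          rw [Finset.mul_sum]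
          exact Finset.sum_congr rfl fun s _ => by ring
      _ = ∑ s, V s * V' s := by
          refine Eq.symm ?_
          calc ∑ s, V s * V' s
              = ∑ s, ∑ j, ∑ k, (X (i₀, j) * P j s) * (X (i₁, k) * P' s k) := by
                refine Finset.sum_congr rfl fun s _ => ?_
                simp only [V, V']
                rw [Finset.sum_mul_sum]
            _ = ∑ j, ∑ s, ∑ k, (X (i₀, j) * P j s) * (X (i₁, k) * P' s k) := Finset.sum_comm
            _ = ∑ j, ∑ k, ∑ s, (X (i₀, j) * P j s) * (X (i₁, k) * P' s k) :=
                Finset.sum_congr rfl fun j _ => Finset.sum_comm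

/-- A linear form whose coefficients vanish outside the rows `i₀, i₁` is
`Σ_j c_{i₀ j} x_{i₀ j} + Σ_k c_{i₁ k} x_{i₁ k}`. [folklore] -/
theorem eq_twoRow_of_coeff_eq_zero {i₀ i₁ : Fin 4} (hi : i₀ ≠ i₁) {ℓ : MvPolynomial (Fin 4 × Fin 4) K}
    (hℓ : ℓ.IsHomogeneous 1)
    (hℓ0 : ∀ w : Fin 4 × Fin 4, w.1 ≠ i₀ → w.1 ≠ i₁ → coeff (Finsupp.single w 1) ℓ = 0) :
    ℓ = ∑ j, C (coeff (Finsupp.single (i₀, j) 1) ℓ) * X (i₀, j) +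
      ∑ k, C (coeff (Finsupp.single (i₁, k) 1) ℓ) * X (i₁, k) := by
  conv_lhs => rw [Literature.RingTheory.MvPolynomial.eq_sum_coeff_single_one_smul_X hℓ]
  rw [Fintype.sum_prod_type, Finset.sum_eq_add_of_mem i₀ i₁ (Finset.mem_univ _) (Finset.mem_univ _)
    hi fun r _ hr => Finset.sum_eq_zero fun c _ => by rw [hℓ0 (r, c) hr.1 hr.2, zero_smul]]
  simp only [smul_eq_C_mul]

/-- **CASE A, rung 1.5, in the binder shape of the registered stub**: for rows `i₀ ≠ i₁` and linear
forms `ℓ, ℓ'` with no coefficients outside the rows `i₀, i₁` (the branch `λ = λ' = 0`), `per_4` is not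
a sum of `b ≤ 5` products of quadrics `v_s ∈ (x_{i₀ ·}, ℓ)`, `v'_s ∈ (x_{i₁ ·}, ℓ')` (`char K ≠ 2`).
[cite: BlaserIkenmeyerMahajanPandeySaurabh2020, §2 (problem)] -/
theorem caseA_of_coeff_eq_zero (h2 : (2 : K) ≠ 0) (b : ℕ) (hb : b ≤ 5) (i₀ i₁ : Fin 4) (hi : i₀ ≠ i₁)
    (ℓ ℓ' : MvPolynomial (Fin 4 × Fin 4) K) (hℓ : ℓ.IsHomogeneous 1) (hℓ' : ℓ'.IsHomogeneous 1)
    (hℓ0 : ∀ w : Fin 4 × Fin 4, w.1 ≠ i₀ → w.1 ≠ i₁ → coeff (Finsupp.single w 1) ℓ = 0)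
    (hℓ'0 : ∀ w : Fin 4 × Fin 4, w.1 ≠ i₀ → w.1 ≠ i₁ → coeff (Finsupp.single w 1) ℓ' = 0)
    (v v' : Fin b → MvPolynomial (Fin 4 × Fin 4) K)
    (hv : ∀ s, v s ∈ Ideal.span (insert ℓ (Set.range fun j : Fin 4 =>
      (X (i₀, j) : MvPolynomial (Fin 4 × Fin 4) K))))
    (hv2 : ∀ s, (v s).IsHomogeneous 2)
    (hv' : ∀ s, v' s ∈ Ideal.span (insert ℓ' (Set.range fun k : Fin 4 =>
      (X (i₁, k) : MvPolynomial (Fin 4 × Fin 4) K))))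
    (hv'2 : ∀ s, (v' s).IsHomogeneous 2) :
    perPoly (Fin 4) K ≠ ∑ s, v s * v' s := by
  rw [eq_twoRow_of_coeff_eq_zero hi hℓ hℓ0] at hv
  rw [eq_twoRow_of_coeff_eq_zero hi hℓ' hℓ'0] at hv'
  exact caseA_twoRow h2 b hb i₀ i₁ hi _ _ _ _ v v' hv hv2 hv' hv'2

end Summit.ValiantsHypothesis.LiftNullstellensatz

end
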